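import Literature.MathematicalPhysics.QuantumFieldTheory.ONVectorSumRule
import Literature.MathematicalPhysics.QuantumFieldTheory.ConformalBootstrap3D.MeanFieldAllSpins
import HarnessLib

/-!
# Non-vacuity of the `O(N)` vector sum rule: the generalised free vector field solves the
# Kos–Poland–Simmons-Duffin crossing system with non-negative weights on typed 3D blocks

HONEST FRAMING (ENGINES group, engine `certsdp`, verifier-B / conformal-bootstrap client path): shared
numerical engines serving client cells; rigour lives in the verifiers; every published number belongs to a
client cell's ledger, not to the engines group.  A Literature module: published statements re-proved in the
kernel over the tree's own objects, no named facts, no `sorry`, nothing numerical.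

## Why this file

`ONVectorSumRule.lean` types the `O(N)` crossing system of Kos–Poland–Simmons-Duffin 2014 (§2.1: the three
tensor structures, `F^∓`, `V_S, V_T, V_A`, crossing ⟺ vector sum rule) and its exclusion step
(`false_of_pointFunctional`, §2.2) over OPAQUE channel functions.  A theorem of the form "positivity of a
functional on every `V_R[g_𝒪]` ⇒ `False`" is only as good as its hypothesis class is consistent, and the signs
of `V_A = (−F⁻, F⁻, −F⁺)` relative to the antisymmetric structure are exactly the kind of convention a typo
inverts (cf. the A3 sign erratum of the `σ–ε` system, 2026-08-19, and the non-vacuity witnesses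
`ConformalBootstrap3D/SingleCorrelatorNonVacuity.lean`, `DecoupledPairNonVacuity.lean` written in response).
This file supplies the analogous witness for the `O(N)` system: GENUINE unitary CFT data — `N` decoupled
generalised free fields of dimension `p > 1/2`, expanded in the tree's typed 3D blocks `hrBlock` with explicit
NON-NEGATIVE weights in all three channels — on which every hypothesis of `false_of_pointFunctional` except
the functional's positivity holds; hence no point functional can satisfy the positivity conditions on it
(`not_pointFunctional_excludes_gff`).  For a certificate reader this is the planted-TRUE control of the `O(N)`
rows: a `points` certificate whose assumed spectrum allows the generalised free double-twist families — in
particular any scalar-gap assumption `Δ_S^* ≤ 2Δφ`, `Δ_T^* ≤ 2Δφ` (`false_of_pointFunctional_gaps_le`) — is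
invalid, whatever its numbers say.

## Sources (read from the held texts) and dictionary

* J. Henriksson, M. van Loon, *Critical O(N) model to order ε⁴ from analytic bootstrap*, J. Phys. A 52
  (2019) 025401, arXiv:1801.03512 [HenrikssonVanLoon2018], §2 "Large spin perturbation theory with global
  symmetry" (held text `paper:arxiv-1801.03512`, chunk p0004):
  > `𝒢_{ijkl}(z,z̄) = 𝒢_S T^S_{ijkl} + 𝒢_T T^T_{ijkl} + 𝒢_A T^A_{ijkl}`, `T^S = δᵢⱼδₖₗ`,
  > `T^T = (δᵢₖδⱼₗ + δᵢₗδⱼₖ)/2 − (1/N) δᵢⱼδₖₗ`, `T^A = (δᵢₖδⱼₗ − δᵢₗδⱼₖ)/2`. […] The correlator in the generalized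
  > free theory is simply `𝒢^{(0)}_{ijkl} = δᵢⱼδₖₗ + u^{Δφ} δᵢₖδⱼₗ + (u/v)^{Δφ} δᵢₗδⱼₖ`, which implies that
  > `𝒢^{(0)}_S = 1 + (1/N) u^{Δφ}(1 + v^{-Δφ})`, `𝒢^{(0)}_T = u^{Δφ}(1 + v^{-Δφ})`, `𝒢^{(0)}_A = u^{Δφ}(1 − v^{-Δφ})`.
  > The intermediate operators have dimensions `Δ_{n,ℓ} = 2Δφ + 2n + ℓ` […] The OPE coefficients `a_{T,Δ,ℓ}` […]
  > match the OPE coefficients in the `⟨φφφφ⟩` correlator in the theory of a single generalized free field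
  > […] for even `ℓ`, with the odd spin OPE coefficients vanishing. […] The OPE coefficients of operators in the
  > antisymmetric representation are of the exact same form, except that the formula is valid only for odd `ℓ`.
* F. Kos, D. Poland, D. Simmons-Duffin, JHEP 06 (2014) 091, arXiv:1307.6856 [KosPolandSimmonsduffin2014ON],
  §2.1–§2.2 (the system and the exclusion step, as typed in `ONVectorSumRule.lean`; §2.2 "we assume that all
  the singlet scalars have dimension above a certain value `Δ_S^*`").
* A. L. Fitzpatrick, J. Kaplan, JHEP 10 (2012) 032, §2.2 [FitzpatrickKaplan2012] — the mean-field coefficients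
  `P_{n,ℓ}(p)` (`ConformalBootstrap3D.mftCoeff`), whose 3D block decompositions are the TREE THEOREMS
  `hasSum_gff_blocks` (`u^p + (u/v)^p`, even spins), `hasSum_mft_blocks_uv` (`(u/v)^p = Σ_{n,ℓ} P_{n,ℓ} g`, all
  spins) and `hasSum_mft_blocks_u` (`u^p = Σ_{n,ℓ} (−1)^ℓ P_{n,ℓ} g`) of `MeanFieldDecomposition` /
  `MeanFieldAllSpins` (`p > 1/2`, `z, z̄ ∈ (0,1)`).

DICTIONARY.  The Kos–Poland–Simmons-Duffin structures of `ONVectorSumRule` are `tS = T^S`, `tT = 2 T^T`,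
`tA = −2 T^A` (`tT_eq_two_mul_hvlTT`), so against THEM the generalised free channel sums are
`𝒢_S = 1 + (1/N)(u^p + (u/v)^p)` (`gffS`), `𝒢_T = ½(u^p + (u/v)^p)` (`gffT = hvlGT/2`) and
`𝒢_A = ½((u/v)^p − u^p)` (`gffA = −hvlGA/2`); both decompositions give the same correlator
`δᵢⱼδₖₗ + u^p δᵢₖδⱼₗ + (u/v)^p δᵢₗδⱼₖ` (`corr_gff`, `gff_channels_hvl`).  Cross-ratios `(u,v)` versus the
variables `(z,z̄)` of the typed blocks: on the real diamond `u = z z̄`, `v = (1−z)(1−z̄)`, `z, z̄ ∈ (0,1)`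
(`InDiamond`), the roots `zOfUV ≤ zbOfUV` of `t² − (1+u−v)t + u` recover `min(z,z̄), max(z,z̄)` (`zOfUV_eq_min`,
`zbOfUV_eq_max`, `InDiamond.roots`); a typed block read as a channel function of `(u,v)` is
`blockUV Δ ℓ u v = hrBlock Δ ℓ (zOfUV u v) (zbOfUV u v)`, and the mirror point `(v,u)` is `(1−z,1−z̄)` (`InDiamond.symm`).

## What is proved

* §1 `corr_gff`, `crossingAt_gff` — the generalised free vector field satisfies `CrossingAt N p` at every
  `u, v > 0`, for EVERY `N` (pure algebra: `v^p(δᵢⱼδₖₗ + u^p δᵢₖδⱼₗ + (u/v)^p δᵢₗδⱼₖ)` is invariant under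
  `(i,u) ↔ (k,v)`); with the opposite sign of `𝒢_A` it would not be (the function-level identity already pins
  the sign of `V_A`); the verbatim Henriksson–van Loon forms and the dictionary (`hvlTT`, `hvlTA`, `hvlGT`,
  `hvlGA`, `tT_eq_two_mul_hvlTT`, `gff_channels_hvl`).
* §2–§3 the diamond/root bookkeeping and `gff_blocks_typed`: every block used, `(Δ, ℓ) = (2p+2n+ℓ, ℓ)`, lies
  strictly above the 3D unitarity bound and `hrBlock Δ ℓ` IS a typed block (`IsConformalBlock3D 0 0 Δ ℓ`, by
  `IsAdmissible3D.isConformalBlock3D_hrBlock`).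
* §4 the three channel decompositions at any diamond point, as `HasSum` identities with non-negative weights:
  `hasSum_gffS` (`𝒢_S − 1 = Σ (2/N) P_{n,2m} g_{2p+2n+2m,2m}`), `hasSum_gffT` (`Σ P_{n,2m} g`), `hasSum_gffA`
  (`𝒢_A = Σ P_{n,2m+1} g_{2p+2n+2m+1,2m+1}`: odd spins, POSITIVE weights — half the difference of the two
  all-spin mean-field decompositions, re-indexed to odd `ℓ`; this is the block-level confirmation of the sign
  conventions of `V_A` and `tA`).
* §5 `not_pointFunctional_excludes_gff` (`2 ≤ N`, `p > 1/2`, any finite set of diamond points, any weights):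
  the conjunction of the four positivity hypotheses of `false_of_pointFunctional` on the generalised free
  families is FALSE; `false_of_pointFunctional_allowing_gff` (spectrum-predicate form) and
  `false_of_pointFunctional_gaps_le` (the Kos–Poland–Simmons-Duffin assumption set with `Δ_S^* ≤ 2p`,
  `Δ_T^* ≤ 2p`).

NOT covered (said once): the free theory itself (`p = 1/2`, operators AT the unitarity bound — the tree's
mean-field decompositions are stated for `p > 1/2`; the single-correlator free witness is
`FreeScalarBlockDecomposition`); derivative functionals (they need termwise differentiability, cf.
`ONVectorSumRule`); the `O(N) ⊗` singlet mixed system of `ONMixedSumRule.lean` and the `O(2)` system of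
`O2ThreeScalarCrossing.lean` (their generalised free witnesses need the unequal-dimension mean-field
decompositions); Henriksson–van Loon's decomposed crossing relations (the `3 × 3` channel mixing matrix) are not
restated.  Nothing here is a statement about the critical `O(N)` models.
-/

namespace Literature.MathematicalPhysics.QuantumFieldTheory.ONVectorNonVacuity

open Set Literature.MathematicalPhysics.QuantumFieldTheory.ONVectorSumRule
  Literature.MathematicalPhysics.QuantumFieldTheory.ConformalBootstrap3D

noncomputable section

variable {N : ℕ}

/-! ## §1 The channel sums of `N` decoupled generalised free fields and their crossing symmetry -/

/-- Singlet channel sum of the `O(N)` generalised free vector field of dimension `p`, unit operator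
included: `𝒢_S = 1 + (1/N)(u^p + (u/v)^p)` (Henriksson–van Loon §2, `𝒢^{(0)}_S = 1 + (1/N) u^{Δφ}(1 + v^{-Δφ})`,
same singlet structure `δᵢⱼδₖₗ`). [cite: HenrikssonVanLoon2018, §2 (generalized free correlator, 𝒢^{(0)}_S)] -/
def gffS (N : ℕ) (p : ℝ) (u v : ℝ) : ℝ := 1 + 1 / (N : ℝ) * (u ^ p + u ^ p / v ^ p)

/-- Traceless-symmetric channel sum `𝒢_T = ½ (u^p + (u/v)^p)` against the structure
`δᵢₗδⱼₖ + δᵢₖδⱼₗ − (2/N)δᵢⱼδₖₗ` of Kos–Poland–Simmons-Duffin (= twice the structure `T^T` of Henriksson–van Loon,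
whose `𝒢^{(0)}_T = u^{Δφ}(1 + v^{-Δφ})` is therefore halved). [cite: HenrikssonVanLoon2018, §2 (𝒢^{(0)}_T)] -/
def gffT (p : ℝ) (u v : ℝ) : ℝ := (u ^ p + u ^ p / v ^ p) / 2

/-- Antisymmetric channel sum `𝒢_A = ½ ((u/v)^p − u^p)` against the structure `δᵢₗδⱼₖ − δᵢₖδⱼₗ` of
Kos–Poland–Simmons-Duffin (= `−2 ×` the structure `T^A = (δᵢₖδⱼₗ − δᵢₗδⱼₖ)/2` of Henriksson–van Loon, whose
`𝒢^{(0)}_A = u^{Δφ}(1 − v^{-Δφ})` is therefore multiplied by `−1/2`). [cite: HenrikssonVanLoon2018, §2 (𝒢^{(0)}_A)] -/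
def gffA (p : ℝ) (u v : ℝ) : ℝ := (u ^ p / v ^ p - u ^ p) / 2

/-- `δᵢⱼ = δⱼᵢ` for the real Kronecker delta of `ONVectorSumRule`. Plumbing. [folklore] -/
private theorem kdelta_comm (i j : Fin N) : kd i j = kd j i := by
  unfold kd
  by_cases h : i = j
  · subst h; rfl
  · rw [if_neg h, if_neg (Ne.symm h)]

/-- **The generalised free correlator on the three tensor structures**: with the channel sums above,
`δᵢⱼδₖₗ 𝒢_S + (δᵢₗδⱼₖ + δᵢₖδⱼₗ − (2/N)δᵢⱼδₖₗ) 𝒢_T + (δᵢₗδⱼₖ − δᵢₖδⱼₗ) 𝒢_A = δᵢⱼδₖₗ + u^p δᵢₖδⱼₗ + (u/v)^p δᵢₗδⱼₖ`,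
the stripped four-point function `x₁₂^{2p}x₃₄^{2p}⟨φᵢφⱼφₖφₗ⟩` of `N` decoupled generalised free fields (Wick
pairings `(12)(34)`, `(13)(24)`, `(14)(23)`). Every `N` (for `N = 0` there are no indices).
[cite: HenrikssonVanLoon2018, §2 (𝒢^{(0)}_{ijkl} = δᵢⱼδₖₗ + u^{Δφ} δᵢₖδⱼₗ + (u/v)^{Δφ} δᵢₗδⱼₖ)] -/
theorem corr_gff (p : ℝ) (i j k l : Fin N) (u v : ℝ) :
    corr (gffS N p) (gffT p) (gffA p) i j k l u v =
      kd i j * kd k l + kd i k * kd j l * u ^ p + kd i l * kd j k * (u ^ p / v ^ p) := by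
  simp only [corr, tS, tT, tA, gffS, gffT, gffA]
  ring

/-- **The generalised free vector field is crossing symmetric** in the sense `CrossingAt` of the
Kos–Poland–Simmons-Duffin system (`v^p f_{ijkl}(u,v) = u^p f_{kjil}(v,u)`), at every point with `u, v > 0`
and for every `N`. [cite: HenrikssonVanLoon2018, §2 (crossing equation and generalized free correlator)]
[cite: KosPolandSimmonsduffin2014ON, §2.1] -/
theorem crossingAt_gff (N : ℕ) (p : ℝ) {u v : ℝ} (hu : 0 < u) (hv : 0 < v) :
    CrossingAt N p (gffS N p) (gffT p) (gffA p) u v := by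
  intro i j k l
  rw [corr_gff, corr_gff, kdelta_comm k j, kdelta_comm k i, kdelta_comm j i, kdelta_comm k l]
  have hup : 0 < u ^ p := Real.rpow_pos_of_pos hu p
  have hvp : 0 < v ^ p := Real.rpow_pos_of_pos hv p
  field_simp
  ring

/-- Henriksson–van Loon's traceless-symmetric structure `T^T_{ijkl} = (δᵢₖδⱼₗ + δᵢₗδⱼₖ)/2 − (1/N) δᵢⱼδₖₗ`
(half of the Kos–Poland–Simmons-Duffin structure `tT`). [cite: HenrikssonVanLoon2018, §2 (basis of tensor structures)] -/
def hvlTT (i j k l : Fin N) : ℝ := (kd i k * kd j l + kd i l * kd j k) / 2 - 1 / (N : ℝ) * (kd i j * kd k l)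

/-- Henriksson–van Loon's antisymmetric structure `T^A_{ijkl} = (δᵢₖδⱼₗ − δᵢₗδⱼₖ)/2` (`−1/2` times the
Kos–Poland–Simmons-Duffin structure `tA = δᵢₗδⱼₖ − δᵢₖδⱼₗ`). [cite: HenrikssonVanLoon2018, §2 (basis of tensor structures)] -/
def hvlTA (i j k l : Fin N) : ℝ := (kd i k * kd j l - kd i l * kd j k) / 2

/-- Henriksson–van Loon's `𝒢^{(0)}_T = u^{Δφ}(1 + v^{-Δφ})`, verbatim. [cite: HenrikssonVanLoon2018, §2 (𝒢^{(0)}_T)] -/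
def hvlGT (p : ℝ) (u v : ℝ) : ℝ := u ^ p * (1 + 1 / v ^ p)

/-- Henriksson–van Loon's `𝒢^{(0)}_A = u^{Δφ}(1 − v^{-Δφ})`, verbatim. [cite: HenrikssonVanLoon2018, §2 (𝒢^{(0)}_A)] -/
def hvlGA (p : ℝ) (u v : ℝ) : ℝ := u ^ p * (1 - 1 / v ^ p)

/-- The dictionary between the two printed conventions: `tT = 2 T^T`, `tA = −2 T^A`. [cite: HenrikssonVanLoon2018, §2]
[cite: KosPolandSimmonsduffin2014ON, §2.1] -/
theorem tT_eq_two_mul_hvlTT (i j k l : Fin N) : tT i j k l = 2 * hvlTT i j k l ∧ tA i j k l = -2 * hvlTA i j k l := by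
  simp only [tT, tA, hvlTT, hvlTA]
  constructor <;> ring

/-- Hence the channel sums: `𝒢_S = 𝒢^{(0)}_S = 1 + (1/N) u^p (1 + v^{-p})` (same singlet structure),
`𝒢_T = 𝒢^{(0)}_T / 2`, `𝒢_A = −𝒢^{(0)}_A / 2`, and the two printed decompositions are the same correlator:
`Σ_R 𝒢_R t_R = δᵢⱼδₖₗ 𝒢^{(0)}_S + T^T 𝒢^{(0)}_T + T^A 𝒢^{(0)}_A`. [cite: HenrikssonVanLoon2018, §2 (𝒢^{(0)}_S, 𝒢^{(0)}_T, 𝒢^{(0)}_A)] -/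
theorem gff_channels_hvl (p : ℝ) (i j k l : Fin N) (u v : ℝ) :
    gffS N p u v = 1 + 1 / (N : ℝ) * (u ^ p * (1 + 1 / v ^ p)) ∧ gffT p u v = hvlGT p u v / 2 ∧
      gffA p u v = -hvlGA p u v / 2 ∧
      corr (gffS N p) (gffT p) (gffA p) i j k l u v =
        kd i j * kd k l * gffS N p u v + hvlTT i j k l * hvlGT p u v + hvlTA i j k l * hvlGA p u v := by
  simp only [gffS, gffT, gffA, hvlGT, hvlGA, hvlTT, hvlTA, corr, tS, tT, tA]
  refine ⟨by ring, by ring, by ring, by ring⟩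

/-! ## §2 Cross-ratios of the real diamond: `(u,v) = (z z̄, (1-z)(1-z̄))`, `z, z̄ ∈ (0,1)` -/

/-- `(u,v)` is a point of the **real diamond**: `u = z z̄`, `v = (1-z)(1-z̄)` for some `z, z̄ ∈ (0,1)` — the
region of independent real `z, z̄` on which the typed blocks `hrBlock` and the tree's mean-field decompositions
are stated, and where point functionals sample ("the standard conformal cross-ratios are `u = z z̄`,
`v = (1−z)(1−z̄)`"). [cite: HenrikssonVanLoon2018, §2 (cross-ratios u = z z̄, v = (1−z)(1−z̄))] -/
def InDiamond (u v : ℝ) : Prop :=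
  ∃ z zb : ℝ, z ∈ Ioo (0 : ℝ) 1 ∧ zb ∈ Ioo (0 : ℝ) 1 ∧ u = z * zb ∧ v = (1 - z) * (1 - zb)

/-- The smaller root of `t² − (1+u−v)t + u`: recovers `min(z, z̄)` from the cross-ratios `u = z z̄`,
`v = (1−z)(1−z̄)`. [cite: HenrikssonVanLoon2018, §2 (cross-ratios u = z z̄, v = (1−z)(1−z̄))] -/
def zOfUV (u v : ℝ) : ℝ := (1 + u - v - Real.sqrt ((1 + u - v) ^ 2 - 4 * u)) / 2

/-- The larger root of `t² − (1+u−v)t + u`: recovers `max(z, z̄)` from the cross-ratios `u = z z̄`,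
`v = (1−z)(1−z̄)`. [cite: HenrikssonVanLoon2018, §2 (cross-ratios u = z z̄, v = (1−z)(1−z̄))] -/
def zbOfUV (u v : ℝ) : ℝ := (1 + u - v + Real.sqrt ((1 + u - v) ^ 2 - 4 * u)) / 2

/-- The discriminant at a diamond point is `(z − z̄)²`, so its square root is `|z − z̄|`. Plumbing. [folklore] -/
private theorem sqrt_crossRatioDisc (z zb : ℝ) :
    Real.sqrt ((1 + z * zb - (1 - z) * (1 - zb)) ^ 2 - 4 * (z * zb)) = |z - zb| := by
  have h : (1 + z * zb - (1 - z) * (1 - zb)) ^ 2 - 4 * (z * zb) = (z - zb) ^ 2 := by ring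
  rw [h, Real.sqrt_sq_eq_abs]

/-- Inverting the cross-ratio map: `zOfUV (z z̄) ((1-z)(1-z̄)) = min(z, z̄)`.
[cite: HenrikssonVanLoon2018, §2 (cross-ratios u = z z̄, v = (1−z)(1−z̄))] -/
theorem zOfUV_eq_min (z zb : ℝ) : zOfUV (z * zb) ((1 - z) * (1 - zb)) = min z zb := by
  unfold zOfUV
  rw [sqrt_crossRatioDisc]
  rcases le_total z zb with h | h
  · rw [min_eq_left h, abs_of_nonpos (sub_nonpos.mpr h)]; ring
  · rw [min_eq_right h, abs_of_nonneg (sub_nonneg.mpr h)]; ring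

/-- Inverting the cross-ratio map: `zbOfUV (z z̄) ((1-z)(1-z̄)) = max(z, z̄)`.
[cite: HenrikssonVanLoon2018, §2 (cross-ratios u = z z̄, v = (1−z)(1−z̄))] -/
theorem zbOfUV_eq_max (z zb : ℝ) : zbOfUV (z * zb) ((1 - z) * (1 - zb)) = max z zb := by
  unfold zbOfUV
  rw [sqrt_crossRatioDisc]
  rcases le_total z zb with h | h
  · rw [max_eq_right h, abs_of_nonpos (sub_nonpos.mpr h)]; ring
  · rw [max_eq_left h, abs_of_nonneg (sub_nonneg.mpr h)]; ring

/-- Diamond points from `z, z̄ ∈ (0,1)`. [cite: HenrikssonVanLoon2018, §2 (cross-ratios u = z z̄, v = (1−z)(1−z̄))] -/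
theorem inDiamond_of_mem {z zb : ℝ} (hz : z ∈ Ioo (0 : ℝ) 1) (hzb : zb ∈ Ioo (0 : ℝ) 1) :
    InDiamond (z * zb) ((1 - z) * (1 - zb)) :=
  ⟨z, zb, hz, hzb, rfl, rfl⟩

namespace InDiamond

variable {u v : ℝ}

/-- The mirror `(v,u)` of a diamond point is a diamond point (`(z, z̄) ↦ (1 − z̄, 1 − z)`, the argument of
the right-hand side of the printed crossing equation `((1−z)/z)^{Δφ} 𝒢_{ijkl}(z,z̄) = (z̄/(1−z̄))^{Δφ} 𝒢_{kjil}(1−z̄,1−z)`).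
[cite: HenrikssonVanLoon2018, §2 (crossing equation)] -/
theorem symm (h : InDiamond u v) : InDiamond v u := by
  obtain ⟨z, zb, hz, hzb, rfl, rfl⟩ := h
  exact ⟨1 - z, 1 - zb, ⟨by linarith [hz.2], by linarith [hz.1]⟩, ⟨by linarith [hzb.2], by linarith [hzb.1]⟩,
    rfl, by ring⟩

/-- At a diamond point both cross-ratios are positive. [cite: HenrikssonVanLoon2018, §2 (cross-ratios u = z z̄, v = (1−z)(1−z̄))] -/
theorem pos (h : InDiamond u v) : 0 < u ∧ 0 < v := by
  obtain ⟨z, zb, hz, hzb, rfl, rfl⟩ := h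
  exact ⟨mul_pos hz.1 hzb.1, mul_pos (by linarith [hz.2]) (by linarith [hzb.2])⟩

/-- **The root map inverts the cross-ratios**: at a diamond point, `zOfUV, zbOfUV ∈ (0,1)`,
`zOfUV · zbOfUV = u` and `(1 − zOfUV)(1 − zbOfUV) = v`. [cite: HenrikssonVanLoon2018, §2 (cross-ratios u = z z̄, v = (1−z)(1−z̄))] -/
theorem roots (h : InDiamond u v) :
    zOfUV u v ∈ Ioo (0 : ℝ) 1 ∧ zbOfUV u v ∈ Ioo (0 : ℝ) 1 ∧ zOfUV u v * zbOfUV u v = u ∧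
      (1 - zOfUV u v) * (1 - zbOfUV u v) = v := by
  obtain ⟨z, zb, hz, hzb, rfl, rfl⟩ := h
  rw [zOfUV_eq_min, zbOfUV_eq_max]
  refine ⟨⟨lt_min hz.1 hzb.1, min_lt_iff.mpr (Or.inl hz.2)⟩,
    ⟨lt_max_iff.mpr (Or.inl hz.1), max_lt hz.2 hzb.2⟩, ?_, ?_⟩
  · rcases le_total z zb with h | h
    · rw [min_eq_left h, max_eq_right h]
    · rw [min_eq_right h, max_eq_left h, mul_comm]
  · rcases le_total z zb with h | h
    · rw [min_eq_left h, max_eq_right h]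
    · rw [min_eq_right h, max_eq_left h, mul_comm]

end InDiamond

/-! ## §3 Typed 3D blocks as channel functions of `(u,v)` -/

/-- A typed 3D block `g^{HR}_{Δ,ℓ}` (`hrBlock`, the sum of the Hogervorst–Rychkov `z`-series) read as a
channel function of the cross-ratios on the real diamond: `g(u,v) := g^{HR}_{Δ,ℓ}(zOfUV(u,v), zbOfUV(u,v))`.
[cite: HogervorstRychkov2013, §2.1 eq. (2.16)] -/
def blockUV (Δ : ℝ) (ℓ : ℕ) (u v : ℝ) : ℝ := hrBlock Δ ℓ (zOfUV u v) (zbOfUV u v)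

/-- Every block of the generalised free expansion is a typed block of the `σ–ε` system
(`IsConformalBlock3D 0 0`), its point `(2p+2n+ℓ, ℓ)` lying strictly above the 3D unitarity bound for `p > 1/2`.
[cite: FitzpatrickKaplan2012, §2.2] -/
theorem gff_blocks_typed {p : ℝ} (hp : 1 / 2 < p) (n ℓ : ℕ) :
    unitarityBound3D ℓ < 2 * p + 2 * n + ℓ ∧
      IsConformalBlock3D 0 0 (2 * p + 2 * n + ℓ) ℓ (hrBlock (2 * p + 2 * n + ℓ) ℓ) :=
  ⟨unitarityBound3D_lt_twist hp n ℓ,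
    (isAdmissible3D_of_lt (unitarityBound3D_lt_twist hp n ℓ)).isConformalBlock3D_hrBlock⟩

/-! ## §4 The three channel decompositions with non-negative weights -/

section Decompositions

variable {p u v : ℝ}

/-- The singlet weights `(2/N) P_{n,2m}(p)` (`gffOPECoeffSq p (n,m) / N`) are non-negative. [cite: FitzpatrickKaplan2012, §2.2] -/
theorem gffS_weight_nonneg (N : ℕ) (hp : 1 / 2 < p) (nm : ℕ × ℕ) : 0 ≤ gffOPECoeffSq p nm / N :=
  div_nonneg (gffOPECoeffSq_pos hp nm).le (Nat.cast_nonneg N)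

/-- **Singlet channel**: at a diamond point, `𝒢_S − 1 = Σ_{n,m} (2/N) P_{n,2m}(p) g_{2p+2n+2m,2m}` (even spins,
double-twist dimensions `2p+2n+2m`, weights `≥ 0`). [cite: HenrikssonVanLoon2018, §2 (𝒢^{(0)}_S and a^{GFF})]
[cite: FitzpatrickKaplan2012, §2.2] -/
theorem hasSum_gffS (N : ℕ) (hp : 1 / 2 < p) (h : InDiamond u v) :
    HasSum (fun nm : ℕ × ℕ => gffOPECoeffSq p nm / N *
        blockUV (2 * p + 2 * nm.1 + 2 * nm.2) (2 * nm.2) u v) (gffS N p u v - 1) := by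
  obtain ⟨hz, hzb, hprod, hprod'⟩ := h.roots
  have hs := (hasSum_gff_blocks hp hz hzb).mul_left (1 / (N : ℝ))
  have hval : 1 / (N : ℝ) * meanFieldCorrelator p (zOfUV u v) (zbOfUV u v) = gffS N p u v - 1 := by
    rw [meanFieldCorrelator, hprod, hprod', gffS]
    ring
  rw [hval] at hs
  have hfun : (fun nm : ℕ × ℕ => gffOPECoeffSq p nm / N *
      blockUV (2 * p + 2 * nm.1 + 2 * nm.2) (2 * nm.2) u v) = fun nm : ℕ × ℕ => 1 / (N : ℝ) *
      (gffOPECoeffSq p nm * hrBlock (2 * p + 2 * nm.1 + 2 * nm.2) (2 * nm.2) (zOfUV u v) (zbOfUV u v)) := by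
    funext nm
    simp only [blockUV]
    ring
  rw [hfun]
  exact hs

/-- **Traceless-symmetric channel**: at a diamond point, `𝒢_T = Σ_{n,m} P_{n,2m}(p) g_{2p+2n+2m,2m}` (even
spins, weights `> 0`). [cite: HenrikssonVanLoon2018, §2 (𝒢^{(0)}_T, "a_{T,Δ,ℓ} … generalized free field OPE coefficients")]
[cite: FitzpatrickKaplan2012, §2.2] -/
theorem hasSum_gffT (hp : 1 / 2 < p) (h : InDiamond u v) :
    HasSum (fun nm : ℕ × ℕ => mftCoeff p nm.1 (2 * nm.2) *
        blockUV (2 * p + 2 * nm.1 + 2 * nm.2) (2 * nm.2) u v) (gffT p u v) := by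
  obtain ⟨hz, hzb, hprod, hprod'⟩ := h.roots
  have hs := (hasSum_gff_blocks hp hz hzb).mul_left (1 / 2 : ℝ)
  have hval : (1 / 2 : ℝ) * meanFieldCorrelator p (zOfUV u v) (zbOfUV u v) = gffT p u v := by
    rw [meanFieldCorrelator, hprod, hprod', gffT]
    ring
  rw [hval] at hs
  have hfun : (fun nm : ℕ × ℕ => mftCoeff p nm.1 (2 * nm.2) *
      blockUV (2 * p + 2 * nm.1 + 2 * nm.2) (2 * nm.2) u v) = fun nm : ℕ × ℕ => (1 / 2 : ℝ) *
      (gffOPECoeffSq p nm * hrBlock (2 * p + 2 * nm.1 + 2 * nm.2) (2 * nm.2) (zOfUV u v) (zbOfUV u v)) := by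
    funext nm
    simp only [blockUV, gffOPECoeffSq]
    ring
  rw [hfun]
  exact hs

/-- **Antisymmetric channel**: at a diamond point, `𝒢_A = Σ_{n,m} P_{n,2m+1}(p) g_{2p+2n+2m+1,2m+1}` — ODD
spins only, with the SAME positive mean-field weights (the difference of the two all-spin mean-field
decompositions `(u/v)^p = Σ P g` and `u^p = Σ (−1)^ℓ P g` of the tree, halved; the sign of `𝒢_A` is the one forced by
the antisymmetric structure `δᵢₗδⱼₖ − δᵢₖδⱼₗ`; "antisymmetric representation … the exact same form … valid only
for odd ℓ"). [cite: HenrikssonVanLoon2018, §2 (𝒢^{(0)}_A and the odd-spin OPE coefficients)]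
[cite: FitzpatrickKaplan2012, §2.2] -/
theorem hasSum_gffA (hp : 1 / 2 < p) (h : InDiamond u v) :
    HasSum (fun nm : ℕ × ℕ => mftCoeff p nm.1 (2 * nm.2 + 1) *
        blockUV (2 * p + 2 * (nm.1 : ℕ) + ((2 * nm.2 + 1 : ℕ) : ℝ)) (2 * nm.2 + 1) u v) (gffA p u v) := by
  obtain ⟨hz, hzb, hprod, hprod'⟩ := h.roots
  have huv := hasSum_mft_blocks_uv hp hz hzb
  have hu := hasSum_mft_blocks_u hp hz hzb
  rw [hprod, hprod'] at huv
  rw [hprod] at hu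
  have hs := (huv.sub hu).mul_left (1 / 2 : ℝ)
  have hval : (1 / 2 : ℝ) * (u ^ p / v ^ p - u ^ p) = gffA p u v := by rw [gffA]; ring
  rw [hval] at hs
  -- the signed family vanishes on even spins; re-index the odd spins `ℓ = 2m+1`
  set f : ℕ × ℕ → ℝ := fun m => (1 / 2 : ℝ) * (mftCoeff p m.1 m.2 *
      hrBlock (2 * p + 2 * m.1 + m.2) m.2 (zOfUV u v) (zbOfUV u v) -
    (-1 : ℝ) ^ m.2 * mftCoeff p m.1 m.2 * hrBlock (2 * p + 2 * m.1 + m.2) m.2 (zOfUV u v) (zbOfUV u v)) with hf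
  have hs' : HasSum f (gffA p u v) := by
    convert hs using 1
  set g : ℕ × ℕ → ℕ × ℕ := fun nm => (nm.1, 2 * nm.2 + 1) with hg
  have hginj : Function.Injective g := by
    intro a b hab
    simp only [hg, Prod.mk.injEq] at hab
    exact Prod.ext hab.1 (by omega)
  have hzero : ∀ x ∉ Set.range g, f x = 0 := by
    intro x hx
    have heven : Even x.2 := by
      rcases Nat.even_or_odd x.2 with he | ⟨r, hr⟩
      · exact he
      · exact absurd ⟨(x.1, r), by simp only [hg]; exact Prod.ext rfl (by omega)⟩ hx
    simp only [hf, heven.neg_one_pow]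
    ring
  have hfg := (hginj.hasSum_iff hzero).mpr hs'
  convert hfg using 1
  funext nm
  have hodd : Odd (2 * nm.2 + 1) := ⟨nm.2, rfl⟩
  simp only [Function.comp, hg, hf, blockUV, hodd.neg_one_pow]
  push_cast
  ring

end Decompositions

/-! ## §5 The witness: no point functional excludes the generalised free vector field -/

/-- **Non-vacuity of the `O(N)` exclusion step / the planted-true control.** For `2 ≤ N`, `p > 1/2` and ANY
point functional `α = Σ_m Σ_r w_{m,r} ev_{(u_m,v_m),r}` at finitely many diamond points: the positivity
hypotheses of `ONVectorSumRule.false_of_pointFunctional` cannot all hold on the generalised free data —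
`α ≥ 0` on every `V_S[g]`, `V_T[g]` of the even-spin double twists `(2p+2n+2m, 2m)` and every `V_A[g]` of the
odd-spin double twists `(2p+2n+2m+1, 2m+1)`, together with `α(V_S[1]) > 0`, is contradictory. Equivalently: no
point-functional certificate can exclude an `O(N)` spectrum at external dimension `Δφ = p` that contains the
generalised free double-twist families; a certificate claiming to do so is wrong (the generalised free vector
field — `N` decoupled generalised free fields — is unitary crossing-symmetric CFT data for every `p ≥ 1/2`).
[cite: HenrikssonVanLoon2018, §2] [cite: KosPolandSimmonsduffin2014ON, §2.2] -/
theorem not_pointFunctional_excludes_gff (hN : 2 ≤ N) {p : ℝ} (hp : 1 / 2 < p) {M : ℕ}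
    (w : Fin M → Fin 3 → ℝ) (u v : Fin M → ℝ) (huv : ∀ m, InDiamond (u m) (v m)) :
    ¬ ((∀ nm : ℕ × ℕ, 0 ≤ pointFunctional w u v
          (fun u' v' => VS p (blockUV (2 * p + 2 * nm.1 + 2 * nm.2) (2 * nm.2)) u' v')) ∧
       (∀ nm : ℕ × ℕ, 0 ≤ pointFunctional w u v
          (fun u' v' => VT N p (blockUV (2 * p + 2 * nm.1 + 2 * nm.2) (2 * nm.2)) u' v')) ∧
       (∀ nm : ℕ × ℕ, 0 ≤ pointFunctional w u v
          (fun u' v' => VA p (blockUV (2 * p + 2 * (nm.1 : ℕ) + ((2 * nm.2 + 1 : ℕ) : ℝ)) (2 * nm.2 + 1)) u' v')) ∧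
       0 < pointFunctional w u v (fun u' v' => VS p (fun _ _ => (1 : ℝ)) u' v')) := by
  rintro ⟨hS, hT, hA, hunit⟩
  exact false_of_pointFunctional hN w u v p
    (pS := fun nm : ℕ × ℕ => gffOPECoeffSq p nm / N) (pT := fun nm : ℕ × ℕ => mftCoeff p nm.1 (2 * nm.2))
    (pA := fun nm : ℕ × ℕ => mftCoeff p nm.1 (2 * nm.2 + 1))
    (gS := fun nm => blockUV (2 * p + 2 * nm.1 + 2 * nm.2) (2 * nm.2))
    (gT := fun nm => blockUV (2 * p + 2 * nm.1 + 2 * nm.2) (2 * nm.2))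
    (gA := fun nm => blockUV (2 * p + 2 * (nm.1 : ℕ) + ((2 * nm.2 + 1 : ℕ) : ℝ)) (2 * nm.2 + 1))
    (GS := gffS N p) (GT := gffT p) (GA := gffA p)
    (fun nm => gffS_weight_nonneg N hp nm) (fun nm => mftCoeff_nonneg hp _ _)
    (fun nm => mftCoeff_nonneg hp _ _)
    (fun m => hasSum_gffS N hp (huv m)) (fun m => hasSum_gffS N hp (huv m).symm)
    (fun m => hasSum_gffT hp (huv m)) (fun m => hasSum_gffT hp (huv m).symm)
    (fun m => hasSum_gffA hp (huv m)) (fun m => hasSum_gffA hp (huv m).symm)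
    (fun m => crossingAt_gff N p (huv m).pos.1 (huv m).pos.2) hS hT hA hunit

/-- **Corollary (assumed spectra containing the generalised free families are never excluded by a point
functional).** If a point functional at diamond points is `≥ 0` on `V_S[g_{Δ,ℓ}]`, `V_T[g_{Δ,ℓ}]`,
`V_A[g_{Δ,ℓ}]` for every `(Δ, ℓ)` allowed by spectrum assumptions `P_S, P_T, P_A`, is `> 0` on the unit
vector, and the assumptions allow the double twists (`P_S, P_T ∋ (2p+2n+2m, 2m)`, `P_A ∋ (2p+2n+2m+1, 2m+1)`),
then `False` — the shape in which a `points`-type certificate for the `O(N)` system states its claim.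
[cite: KosPolandSimmonsduffin2014ON, §2.2] [cite: HenrikssonVanLoon2018, §2] -/
theorem false_of_pointFunctional_allowing_gff (hN : 2 ≤ N) {p : ℝ} (hp : 1 / 2 < p) {M : ℕ}
    (w : Fin M → Fin 3 → ℝ) (u v : Fin M → ℝ) (huv : ∀ m, InDiamond (u m) (v m))
    (PS PT PA : ℝ → ℕ → Prop)
    (hPS : ∀ n m : ℕ, PS (2 * p + 2 * n + 2 * m) (2 * m)) (hPT : ∀ n m : ℕ, PT (2 * p + 2 * n + 2 * m) (2 * m))
    (hPA : ∀ n m : ℕ, PA (2 * p + 2 * n + ((2 * m + 1 : ℕ) : ℝ)) (2 * m + 1))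
    (hposS : ∀ Δ ℓ, PS Δ ℓ → 0 ≤ pointFunctional w u v (fun u' v' => VS p (blockUV Δ ℓ) u' v'))
    (hposT : ∀ Δ ℓ, PT Δ ℓ → 0 ≤ pointFunctional w u v (fun u' v' => VT N p (blockUV Δ ℓ) u' v'))
    (hposA : ∀ Δ ℓ, PA Δ ℓ → 0 ≤ pointFunctional w u v (fun u' v' => VA p (blockUV Δ ℓ) u' v'))
    (hunit : 0 < pointFunctional w u v (fun u' v' => VS p (fun _ _ => (1 : ℝ)) u' v')) : False :=
  not_pointFunctional_excludes_gff hN hp w u v huv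
    ⟨fun nm => hposS _ _ (hPS nm.1 nm.2), fun nm => hposT _ _ (hPT nm.1 nm.2),
      fun nm => hposA _ _ (hPA nm.1 nm.2), hunit⟩

/-- **Corollary (scalar-gap assumptions below the generalised free line are never excluded by a point
functional).** The usual `O(N)` assumption set — channel `S`: even spins, `Δ ≥` unitarity bound, scalars
`Δ ≥ Δ_S^*`; channel `T`: even spins, unitarity, scalars `Δ ≥ Δ_T^*`; channel `A`: odd spins, unitarity — with
`Δ_S^* ≤ 2p` and `Δ_T^* ≤ 2p` ALLOWS the generalised free vector field of dimension `p`, so no point functional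
at diamond points satisfies the certificate conditions for it (Kos–Poland–Simmons-Duffin §2.2: "we assume that
all the singlet scalars have dimension above a certain value `Δ_S^*` … try to find a linear functional"). A
`points` certificate for these rows with such gaps is therefore invalid — the planted-true control.
[cite: KosPolandSimmonsduffin2014ON, §2.2] [cite: HenrikssonVanLoon2018, §2] -/
theorem false_of_pointFunctional_gaps_le (hN : 2 ≤ N) {p : ℝ} (hp : 1 / 2 < p) {M : ℕ}
    (w : Fin M → Fin 3 → ℝ) (u v : Fin M → ℝ) (huv : ∀ m, InDiamond (u m) (v m)) {ΔS ΔT : ℝ}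
    (hΔS : ΔS ≤ 2 * p) (hΔT : ΔT ≤ 2 * p)
    (hposS : ∀ (Δ : ℝ) (ℓ : ℕ), Even ℓ → unitarityBound3D ℓ ≤ Δ → (ℓ = 0 → ΔS ≤ Δ) →
      0 ≤ pointFunctional w u v (fun u' v' => VS p (blockUV Δ ℓ) u' v'))
    (hposT : ∀ (Δ : ℝ) (ℓ : ℕ), Even ℓ → unitarityBound3D ℓ ≤ Δ → (ℓ = 0 → ΔT ≤ Δ) →
      0 ≤ pointFunctional w u v (fun u' v' => VT N p (blockUV Δ ℓ) u' v'))
    (hposA : ∀ (Δ : ℝ) (ℓ : ℕ), Odd ℓ → unitarityBound3D ℓ ≤ Δ →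
      0 ≤ pointFunctional w u v (fun u' v' => VA p (blockUV Δ ℓ) u' v'))
    (hunit : 0 < pointFunctional w u v (fun u' v' => VS p (fun _ _ => (1 : ℝ)) u' v')) : False := by
  have hub : ∀ n ℓ : ℕ, unitarityBound3D ℓ ≤ 2 * p + 2 * n + ℓ := fun n ℓ => (gff_blocks_typed hp n ℓ).1.le
  have hub2 : ∀ n m : ℕ, unitarityBound3D (2 * m) ≤ 2 * p + 2 * n + 2 * m := fun n m => by
    have := hub n (2 * m); push_cast at this; exact this
  have hscal : ∀ {Δ0 : ℝ}, Δ0 ≤ 2 * p → ∀ n m : ℕ, 2 * m = 0 → Δ0 ≤ 2 * p + 2 * n + 2 * m := by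
    intro Δ0 h0 n m hm
    have hm0 : (m : ℝ) = 0 := by exact_mod_cast (show m = 0 by omega)
    have hn : (0 : ℝ) ≤ n := Nat.cast_nonneg n
    rw [hm0]; linarith
  refine false_of_pointFunctional_allowing_gff hN hp w u v huv
    (fun Δ ℓ => Even ℓ ∧ unitarityBound3D ℓ ≤ Δ ∧ (ℓ = 0 → ΔS ≤ Δ))
    (fun Δ ℓ => Even ℓ ∧ unitarityBound3D ℓ ≤ Δ ∧ (ℓ = 0 → ΔT ≤ Δ))
    (fun Δ ℓ => Odd ℓ ∧ unitarityBound3D ℓ ≤ Δ) ?_ ?_ ?_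
    (fun Δ ℓ h => hposS Δ ℓ h.1 h.2.1 h.2.2) (fun Δ ℓ h => hposT Δ ℓ h.1 h.2.1 h.2.2)
    (fun Δ ℓ h => hposA Δ ℓ h.1 h.2) hunit
  · exact fun n m => ⟨even_two_mul m, hub2 n m, hscal hΔS n m⟩
  · exact fun n m => ⟨even_two_mul m, hub2 n m, hscal hΔT n m⟩
  · exact fun n m => ⟨odd_two_mul_add_one m, hub n (2 * m + 1)⟩

end

end Literature.MathematicalPhysics.QuantumFieldTheory.ONVectorNonVacuity
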